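import Literature.Analysis.FunctionSpaces.LittlewoodPaleyInhomogeneousProofs
import Literature.Analysis.FunctionSpaces.BesovDifferenceProofs
import Mathlib.Analysis.SpecialFunctions.JapaneseBracket
import HarnessLib

/-!
# The finite-difference characterisation of the inhomogeneous `B^s_{p,∞}`, `0 < s < 1`
(Triebel 1983, Thm. 2.5.12; BCD Thm. 2.36 with Thm. 2.69): the fact `memBesov_top_iff_memBesovSup`

Sibling proof file of `Literature/Analysis/FunctionSpaces/LittlewoodPaley.lean`, continuing
`LittlewoodPaleyDifferenceProofs.lean` (BCD Thm. 2.36, the homogeneous class `Ḃ^s_{p,∞}` through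
differences) and `LittlewoodPaleyInhomogeneousProofs.lean` (BCD Thm. 2.69, `B^s = L^p ∩ Ḃ^s` for
`s > 0`). It settles the named fact
`Literature.Analysis.FunctionSpaces.memBesov_top_iff_memBesovSup` of `LittlewoodPaley.lean`:
for `f ∈ L^p(E; F)`, `1 ≤ p ≤ ∞`, `0 < s < 1`,

  `f ∈ B^s_{p,∞}` (finite `‖Ṡ₀ f‖_{L^p} + sup_{j ≥ 1} 2^{js} ‖Δ̇_j f‖_{L^p}`)
  `↔ sup_{h ≠ 0} ‖f(· + h) - f‖_{L^p} / ‖h‖^s < ∞` (`MemBesovSup s p f volume`).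

Source: H. Triebel, *Theory of Function Spaces* (1983), §2.5.12, **Theorem** (held; chunks
241–244 of the store copy): for `0 < p ≤ ∞`, `0 < q ≤ ∞`, `s > σ̃_p = n(1/min(p,1) - 1)` and an
integer `M > s`,
`‖f | B^s_{p,q}‖^{(2)}_M = ‖f | L_p‖ + (∫ |h|^{-sq} ‖Δ^M_h f | L_p‖^q dh/|h|^n)^{1/q}`
("modification if `q = ∞`") is an equivalent quasi-norm on `B^s_{p,q}(ℝⁿ)`, and (ibid.,
**Remark 3**) `f ∈ B^s_{p,q}(ℝⁿ)` iff `f ∈ L_p(ℝⁿ)` and `‖f | B^s_{p,q}‖^{(2)}_M < ∞`. The vendored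
fact is the case `1 ≤ p ≤ ∞` (so `σ̃_p = 0`), `q = ∞`, `M = 1`, `0 < s < 1`. The same statement is
Bahouri–Chemin–Danchin 2011, Thm. 2.36 (homogeneous form) combined with Thm. 2.69
(`B^s_{p,r} = L^p ∩ Ḃ^s_{p,r}`, `s > 0`), whose Lean proofs this file reuses.

## Main results (everything here is proved)

* `Literature.Analysis.FunctionSpaces.memBesov_top_iff_memBesovSup_holds :
  memBesov_top_iff_memBesovSup`, **in every dimension (including `E = {0}`) and for every
  `1 ≤ p ≤ ∞`** — unlike the homogeneous fact `memHomBesov_iff_memBesovSup`, the inhomogeneous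
  statement carries no realisation condition and needs no `dim E ≥ 1` / `p < ∞` proviso. Assembled from
  `Literature.Analysis.FunctionSpaces.memBesov_top_coe_of_memBesovSup` (differences ⇒
  Littlewood–Paley, any `s ≥ 0`) and
  `Literature.Analysis.FunctionSpaces.memBesovSup_coe_of_memBesov_top` (Littlewood–Paley ⇒
  differences, `0 < s < 1`).
* `Literature.Analysis.FunctionSpaces.exists_eHomBesovNorm_top_coe_le_eBesovSupSeminorm`:
  `‖f‖_{Ḃ^s_{p,∞}} ≤ C [f]_{B^s_{p,∞}}` for `f ∈ L^p`, now for **all** `1 ≤ p ≤ ∞` (the case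
  `p < ∞` is `eHomBesovNorm_top_coe_le_eBesovSupSeminorm` of `LittlewoodPaleyDifferenceProofs.lean`;
  the new case `p = ∞`, `Literature.Analysis.FunctionSpaces.eHomBesovNorm_top_top_coe_le`, goes
  through the essential supremum instead of Hölder's inequality).
* `Literature.Analysis.FunctionSpaces.memBesovSup_lowFreqCutoff_zero_coe`: the low-frequency part
  `Ṡ₀ f` of an `L^p` function lies in every `B^s_{p,∞}`, `0 ≤ s ≤ 1`
  (`‖τ_h Ṡ₀ f - Ṡ₀ f‖_{L^p} ≤ ‖τ_h κ₀ - κ₀‖_{L¹} ‖f‖_{L^p} ≤ C ‖h‖ ‖f‖_{L^p}`).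
* `Literature.Analysis.FunctionSpaces.exists_eLpNorm_translate_sub_le`: translation is Lipschitz in
  `L¹` on Schwartz functions, `‖θ(· + h) - θ‖_{L¹} ≤ K ‖h‖` for `‖h‖ ≤ 1`.

## The proof

* (`§ TopBlock`, differences ⇒ blocks at `p = ∞`.) As in BCD's proof of Thm. 2.36, `Δ̇₀ v = k₀ ⋆ v`
  with `∫ k₀ = 0`, so `‖(k₀ ⋆ v)(x)‖ ≤ ∫ |k₀(t)| ‖v(x - t) - v(x)‖ dt`
  (`enorm_dyadicKernel_convolution_le`, `LittlewoodPaleyDifferenceProofs.lean`). For `p = ∞` the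
  defining bound `‖v(· - t) - v‖_{L^∞} ≤ [v] ‖t‖^s` holds, for each fixed `t`, for a.e. `x`; by
  Tonelli on the (measurable) exceptional set (`Measure.ae_ae_comm`) it holds for a.e. `x`
  simultaneously for a.e. `t`, whence `‖k₀ ⋆ v‖_{L^∞} ≤ [v] ∫ |k₀(t)| ‖t‖^s dt`
  (`Literature.Analysis.FunctionSpaces.eLpNorm_dyadicKernel_convolution_top_le`). The dyadic
  scaling `Δ̇_j f = (Δ̇₀ f(2^{-j}·))(2^j ·)` of `LittlewoodPaleyProofs.lean` then gives
  `2^{js} ‖Δ̇_j f‖_{L^∞} ≤ C [f]` for all `j`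
  (`Literature.Analysis.FunctionSpaces.eLpNormDistrib_lpBlock_coe_le_of_zero`, the scaling step
  of `eLpNormDistrib_lpBlock_coe_le` with the frequency-`1` bound as a hypothesis).
* (`§ FromDifferences`.) `Ṡ₀ f ∈ L^p` by Young (`eLpNormDistrib_lowFreqCutoff_coe_lt_top`,
  `LittlewoodPaleyInhomogeneousProofs.lean`) and
  `sup_{j ≥ 1} 2^{js} ‖Δ̇_j f‖_{L^p} ≤ ‖f‖_{Ḃ^s_{p,∞}} ≤ C [f] < ∞`.
* (`§ LowFreqDifference`, `§ ToDifferences`.) Conversely let `f ∈ L^p` have finite inhomogeneous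
  norm and put `g₀ = Ṡ₀ f ∈ L^p`, `g = f - g₀`. Since `χ(2^{-j}ξ) χ(ξ) = χ(2^{-j}ξ)` for `j ≤ -1`,
  `Ṡ_j g = Ṡ_j f - Ṡ_j Ṡ₀ f = 0` for `j ≤ -1`: `g` satisfies the realisation condition of
  `Ḃ^s_{p,∞}` trivially (no `L^p ⊂ 𝓢'_h` is needed, which is why `p = ∞` and `E = {0}` are
  allowed), and `‖Δ̇_j g‖_{L^p} ≤ (1 + M) ‖Δ̇_j f‖_{L^p}` (`Δ̇_j Ṡ₀ = Ṡ₀ Δ̇_j`,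
  `‖Ṡ₀‖_{L^p → L^p} ≤ M`) with `‖Δ̇_j g‖_{L^p} ≤ 2M ‖g‖_{L^p}` for `j ≤ 0`, so
  `g ∈ Ḃ^s_{p,∞} ∩ L^p` and BCD Thm. 2.36, second inequality
  (`memBesovSup_coe_of_memHomBesov_top`, valid for `1 ≤ p ≤ ∞`) gives
  `[g]_{B^s_{p,∞}} < ∞`. For the low frequencies, `τ_h Ṡ₀ f - Ṡ₀ f = ((e_h - 1)χ)(D) f =
  (τ_h κ₀ - κ₀) ⋆ f` (`κ₀ = 𝓕⁻¹χ`; modulation is translation under `𝓕⁻¹`), so Young's inequality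
  and the `L¹`-Lipschitz bound `‖τ_h κ₀ - κ₀‖_{L¹} ≤ K‖h‖` (mean value inequality under the
  Schwartz decay of `∇κ₀`, Peetre) give `‖τ_h g₀ - g₀‖_{L^p} ≤ K ‖h‖ ‖f‖_{L^p}` for `‖h‖ ≤ 1` and
  `≤ 2‖g₀‖_{L^p}` always, i.e. `[g₀]_{B^s_{p,∞}} < ∞` for `0 ≤ s ≤ 1`. Finally
  `[f] ≤ [g] + [g₀]` (`MemBesovSup.add'`, `BesovDifferenceProofs.lean`).

## References

* H. Triebel, *Theory of Function Spaces*, Monographs in Mathematics 78, Birkhäuser (1983),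
  §2.5.12, Theorem (eq. (4), `M = 1`) and Remark 3; §2.2.2 eq. (5) (`Δ¹_h f = f(· + h) - f`).
  [cite: TriebelTFS1983, §2.5.12 Thm. eq. (4) and Rem. 3] [cite: Triebel1983, Thm. 2.5.12]
* H. Bahouri, J.-Y. Chemin, R. Danchin, *Fourier Analysis and Nonlinear Partial Differential
  Equations*, Grundlehren 343, Springer (2011): Thm. 2.36 (finite differences, homogeneous spaces)
  and its proof; Def. 2.68, Thm. 2.69 / Rem. 2.70 (`B^s_{p,r} = Ḃ^s_{p,r} ∩ L^p`, `s > 0`).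
  [cite: BahouriCheminDanchin2011, Thm. 2.36 and Thm. 2.69]
-/

noncomputable section

open MeasureTheory TemperedDistribution SchwartzMap Filter Topology Function Complex
open scoped SchwartzMap ENNReal NNReal FourierTransform Real RealInnerProductSpace ContDiff
open scoped Convolution

namespace Literature.Analysis.FunctionSpaces

/-! ## Differences ⇒ blocks at `p = ∞` -/

section TopBlock

variable {E : Type*} [NormedAddCommGroup E] [InnerProductSpace ℝ E] [FiniteDimensional ℝ E]
  [MeasurableSpace E] [BorelSpace E] {F : Type*} [NormedAddCommGroup F]

/-- **The `L^∞` difference bound holds jointly almost everywhere.** For an a.e.-strongly measurable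
`v`, for a.e. `x`, for a.e. `t`: `‖v(x - t) - v(x)‖ ≤ [v]_{B^s_{∞,∞}} ‖t‖^s`. For each fixed
`t ≠ 0` this is the defining essential-supremum bound `‖v(· - t) - v‖_{L^∞} ≤ [v] ‖t‖^s`
(`eLpNorm_sub_le_eBesovSupSeminorm_mul` at the increment `-t`), valid for a.e. `x`; the order of
the two "almost everywhere" is exchanged by Tonelli on the measurable exceptional set
(`MeasureTheory.Measure.ae_ae_comm`, for a strongly measurable representative). [folklore] -/
theorem ae_ae_enorm_sub_le_eBesovSupSeminorm_top {v : E → F}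
    (hv : AEStronglyMeasurable v (volume : Measure E)) (s : ℝ) :
    ∀ᵐ x ∂(volume : Measure E), ∀ᵐ t ∂(volume : Measure E),
      ‖v (x - t) - v x‖ₑ ≤ eBesovSupSeminorm s ∞ v volume * ENNReal.ofReal (‖t‖ ^ s) := by
  set A : ℝ≥0∞ := eBesovSupSeminorm s ∞ v volume with hA
  -- a strongly measurable representative `w`
  set w : E → F := hv.mk v with hw
  have hwm : StronglyMeasurable w := hv.stronglyMeasurable_mk
  have hvw : v =ᵐ[volume] w := hv.ae_eq_mk
  have hAw : eBesovSupSeminorm s ∞ w volume = A := (eBesovSupSeminorm_congr_ae hvw).symm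
  -- for each fixed increment, the essential-supremum bound in `x`
  have hfix : ∀ t : E, ∀ᵐ x ∂(volume : Measure E),
      ‖w (x - t) - w x‖ₑ ≤ A * ENNReal.ofReal (‖t‖ ^ s) := by
    intro t
    rcases eq_or_ne t 0 with rfl | ht
    · exact ae_of_all _ fun x => by simp
    have h1 : ∀ᵐ x ∂(volume : Measure E),
        ‖w (x - t) - w x‖ₑ ≤ eLpNormEssSup (fun x => w (x + -t) - w x) volume := by
      have h := enorm_ae_le_eLpNormEssSup (fun x => w (x + -t) - w x) (volume : Measure E)
      simpa only [← sub_eq_add_neg] using h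
    have h2 : eLpNormEssSup (fun x => w (x + -t) - w x) volume ≤ A * ENNReal.ofReal (‖t‖ ^ s) := by
      have h := eLpNorm_sub_le_eBesovSupSeminorm_mul (s := s) (p := ∞) (f := w)
        (μ := (volume : Measure E)) (neg_ne_zero.2 ht)
      rwa [eLpNorm_exponent_top, norm_neg, hAw] at h
    filter_upwards [h1] with x hx using hx.trans h2
  -- exchange the two `∀ᵐ`
  have hmeas : MeasurableSet
      {z : E × E | ‖w (z.1 - z.2) - w z.1‖ₑ ≤ A * ENNReal.ofReal (‖z.2‖ ^ s)} :=
    measurableSet_le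
      ((hwm.comp_measurable (measurable_fst.sub measurable_snd)).sub
        (hwm.comp_measurable measurable_fst)).enorm
      ((measurable_snd.norm.pow_const s).ennreal_ofReal.const_mul A)
  have hw' : ∀ᵐ x ∂(volume : Measure E), ∀ᵐ t ∂(volume : Measure E),
      ‖w (x - t) - w x‖ₑ ≤ A * ENNReal.ofReal (‖t‖ ^ s) :=
    (Measure.ae_ae_comm (μ := (volume : Measure E)) (ν := (volume : Measure E))
      (p := fun x t => ‖w (x - t) - w x‖ₑ ≤ A * ENNReal.ofReal (‖t‖ ^ s)) hmeas).2
      (ae_of_all _ hfix)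
  -- back to `v`
  have hdiag : ∀ᵐ x ∂(volume : Measure E), ∀ᵐ t ∂(volume : Measure E), v (x - t) = w (x - t) := by
    have h := Measure.ae_ae_of_ae_prod
      ((quasiMeasurePreserving_sub_of_right_invariant (volume : Measure E) volume).ae_eq_comp hvw)
    filter_upwards [h] with x hx
    filter_upwards [hx] with t ht
    exact ht
  filter_upwards [hw', hdiag, hvw] with x hx hx' hxv
  filter_upwards [hx, hx'] with t ht ht'
  rw [hxv, ht']
  exact ht

variable [NormedSpace ℂ F] [CompleteSpace F]

/-- **`‖k₀ ⋆ v‖_{L^∞} ≤ C_∞(s) [v]_{B^s_{∞,∞}}`, `C_∞(s) = ∫ |k₀(t)| ‖t‖^s dt`** for `v ∈ L^∞`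
(BCD, proof of Thm. 2.36, first inequality, at frequency `1` and `p = ∞`):
`‖(k₀ ⋆ v)(x)‖ ≤ ∫ |k₀(t)| ‖v(x - t) - v(x)‖ dt` since `∫ k₀ = 0`, and
`‖v(x - t) - v(x)‖ ≤ [v] ‖t‖^s` for a.e. `x`, a.e. `t` (`ae_ae_enorm_sub_le_eBesovSupSeminorm_top`).
[folklore] -/
theorem eLpNorm_dyadicKernel_convolution_top_le (s : ℝ) (v : Lp F ∞ (volume : Measure E)) :
    eLpNorm ((⇑(dyadicKernel E)) ⋆[ContinuousLinearMap.lsmul ℂ ℂ, volume] (v : E → F)) ∞ volume ≤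
      (∫⁻ t, ‖(dyadicKernel E) t‖ₑ * ENNReal.ofReal (‖t‖ ^ s)) *
        eBesovSupSeminorm s ∞ (v : E → F) volume := by
  set k : 𝓢(E, ℂ) := dyadicKernel E with hk
  set A : ℝ≥0∞ := eBesovSupSeminorm s ∞ (v : E → F) volume with hA
  have hmeas : Measurable fun t : E => ‖k t‖ₑ * ENNReal.ofReal (‖t‖ ^ s) :=
    k.continuous.measurable.enorm.mul (measurable_norm.pow_const s).ennreal_ofReal
  rw [eLpNorm_exponent_top]
  refine eLpNormEssSup_le_of_ae_enorm_bound ?_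
  filter_upwards [ae_ae_enorm_sub_le_eBesovSupSeminorm_top (Lp.aestronglyMeasurable v) s] with x hx
  calc ‖((⇑k) ⋆[ContinuousLinearMap.lsmul ℂ ℂ, volume] (v : E → F)) x‖ₑ
      ≤ ∫⁻ t, ‖k t‖ₑ * ‖(v : E → F) (x - t) - (v : E → F) x‖ₑ :=
        enorm_dyadicKernel_convolution_le v x
    _ ≤ ∫⁻ t, ‖k t‖ₑ * (A * ENNReal.ofReal (‖t‖ ^ s)) := by
        refine lintegral_mono_ae ?_
        filter_upwards [hx] with t ht
        gcongr
    _ = A * ∫⁻ t, ‖k t‖ₑ * ENNReal.ofReal (‖t‖ ^ s) := by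
        rw [← lintegral_const_mul _ hmeas]
        refine lintegral_congr fun t => ?_
        ring
    _ = (∫⁻ t, ‖k t‖ₑ * ENNReal.ofReal (‖t‖ ^ s)) * A := mul_comm _ _

/-- The `L^p` norm of the block `Δ̇₀ v` of an `L^p` function is at most the `L^p` norm of the
convolution `k₀ ⋆ v` (in fact equal: `Δ̇₀ v = k₀ ⋆ v` as distributions,
`fourierMultiplierCLM_coe_apply_eq_integral_convolution`), `1 ≤ p ≤ ∞`. [folklore] -/
theorem eLpNormDistrib_lpBlock_zero_coe_le_eLpNorm_convolution {p : ℝ≥0∞} [hp1 : Fact (1 ≤ p)]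
    (v : Lp F p (volume : Measure E)) :
    eLpNormDistrib p (lpBlock 0 (v : 𝓢'(E, F))) ≤
      eLpNorm ((⇑(dyadicKernel E)) ⋆[ContinuousLinearMap.lsmul ℂ ℂ, volume] (v : E → F))
        p volume := by
  set k : 𝓢(E, ℂ) := dyadicKernel E with hk
  have hg : MemLp ((⇑k) ⋆[ContinuousLinearMap.lsmul ℂ ℂ, volume] (v : E → F)) p volume :=
    memLp_convolution_smul (k.integrable (μ := volume)) (Lp.memLp v) hp1.out
  have hrep : ((hg.toLp _ : Lp F p (volume : Measure E)) : 𝓢'(E, F)) =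
      lpBlock 0 (v : 𝓢'(E, F)) := by
    rw [lpBlock_apply, ← coe_dyadicSchwartz]
    ext u
    rw [Lp.toTemperedDistribution_apply, fourierMultiplierCLM_coe_apply_eq_integral_convolution]
    refine integral_congr_ae ?_
    filter_upwards [hg.coeFn_toLp] with y hy
    rw [hy]
    rfl
  calc eLpNormDistrib p (lpBlock 0 (v : 𝓢'(E, F)))
      ≤ ‖(hg.toLp _ : Lp F p (volume : Measure E))‖ₑ := by
        rw [← hrep]; exact eLpNormDistrib_coe_le _
    _ = eLpNorm ((⇑k) ⋆[ContinuousLinearMap.lsmul ℂ ℂ, volume] (v : E → F)) p volume :=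
        Lp.enorm_toLp hg

/-- **`‖Δ̇₀ v‖_{L^∞} ≤ C_∞(s) [v]_{B^s_{∞,∞}}`** for `v ∈ L^∞` (the case `p = ∞` of
`eLpNormDistrib_lpBlock_zero_coe_le`). [folklore] -/
theorem eLpNormDistrib_lpBlock_zero_coe_top_le (s : ℝ) (v : Lp F ∞ (volume : Measure E)) :
    eLpNormDistrib ∞ (lpBlock 0 (v : 𝓢'(E, F))) ≤
      (∫⁻ t, ‖(dyadicKernel E) t‖ₑ * ENNReal.ofReal (‖t‖ ^ s)) *
        eBesovSupSeminorm s ∞ (v : E → F) volume :=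
  (eLpNormDistrib_lpBlock_zero_coe_le_eLpNorm_convolution v).trans
    (eLpNorm_dyadicKernel_convolution_top_le s v)

/-- **All frequencies by dyadic scaling** (BCD, proof of Thm. 2.36, first inequality): if
`‖Δ̇₀ v‖_{L^p} ≤ C [v]_{B^s_{p,∞}}` for every `v ∈ L^p`, then
`‖Δ̇_j f‖_{L^p} ≤ C 2^{-js} [f]_{B^s_{p,∞}}` for every `f ∈ L^p` and `j ∈ ℤ`, by
`Δ̇_j f = (Δ̇₀ f(2^{-j}·))(2^j ·)` and `[f(a ·)] ≤ a^s |a^d|^{-1/p} [f]` — the scaling step of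
`eLpNormDistrib_lpBlock_coe_le` (`LittlewoodPaleyDifferenceProofs.lean`) with the frequency-`1`
bound as a hypothesis, so that it serves `p = ∞` as well.
[cite: BahouriCheminDanchin2011, Thm. 2.36] -/
theorem eLpNormDistrib_lpBlock_coe_le_of_zero {s : ℝ} {p : ℝ≥0∞} [Fact (1 ≤ p)] {C : ℝ≥0∞}
    (hC : ∀ v : Lp F p (volume : Measure E), eLpNormDistrib p (lpBlock 0 (v : 𝓢'(E, F))) ≤
      C * eBesovSupSeminorm s p (v : E → F) volume)
    (f : Lp F p (volume : Measure E)) (j : ℤ) :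
    eLpNormDistrib p (lpBlock j (f : 𝓢'(E, F))) ≤
      C * (2 : ℝ≥0∞) ^ (-((j : ℝ) * s)) * eBesovSupSeminorm s p (f : E → F) volume := by
  set d : ℕ := Module.finrank ℝ E with hd
  set c : ℝˣ := Units.mk0 ((2 : ℝ) ^ j) (zpow_ne_zero j two_ne_zero) with hc
  have hcinv : ((c⁻¹ : ℝˣ) : ℝ) = (2 : ℝ) ^ (-j) := by
    rw [Units.val_inv_eq_inv_val, zpow_neg]; rfl
  have hfc := memLp_comp_smul f c⁻¹
  set fc : Lp F p (volume : Measure E) := hfc.toLp _ with hfc_def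
  have hw : distribDilate c⁻¹ (f : 𝓢'(E, F)) = (fc : 𝓢'(E, F)) :=
    distribDilate_coe_holds c⁻¹ f fc (MemLp.coeFn_toLp hfc)
  have hblock : lpBlock j (f : 𝓢'(E, F)) = distribDilate c (lpBlock 0 (fc : 𝓢'(E, F))) := by
    conv_lhs => rw [← distribDilate_distribDilate_inv c (f : 𝓢'(E, F)), hc,
      lpBlock_distribDilate_holds j j, sub_self]
    rw [← hc, hw]
  -- the seminorm of `f(2^{-j} ·)`
  have hsemi : eBesovSupSeminorm s p (fc : E → F) volume ≤
      (2 : ℝ≥0∞) ^ (((-j : ℤ) : ℝ) * s) * (2 : ℝ≥0∞) ^ (-(((-j : ℤ) : ℝ) * d) / p.toReal) *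
        eBesovSupSeminorm s p (f : E → F) volume := by
    rw [eBesovSupSeminorm_congr_ae (MemLp.coeFn_toLp hfc), hcinv, ← ofReal_two_zpow_rpow,
      ← dilateConst_two_zpow]
    exact eBesovSupSeminorm_comp_smul_le s p _ (zpow_pos two_pos _)
  rw [hblock, eLpNormDistrib_distribDilate, show ((c : ℝˣ) : ℝ) = (2 : ℝ) ^ j from rfl,
    dilateConst_two_zpow]
  calc (2 : ℝ≥0∞) ^ (-((j : ℝ) * d) / p.toReal) * eLpNormDistrib p (lpBlock 0 (fc : 𝓢'(E, F)))
      ≤ (2 : ℝ≥0∞) ^ (-((j : ℝ) * d) / p.toReal) *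
          (C * eBesovSupSeminorm s p (fc : E → F) volume) := by
        gcongr
        exact hC fc
    _ ≤ (2 : ℝ≥0∞) ^ (-((j : ℝ) * d) / p.toReal) *
          (C * ((2 : ℝ≥0∞) ^ (((-j : ℤ) : ℝ) * s) *
            (2 : ℝ≥0∞) ^ (-(((-j : ℤ) : ℝ) * d) / p.toReal) *
              eBesovSupSeminorm s p (f : E → F) volume)) := by
        gcongr
    _ = C * ((2 : ℝ≥0∞) ^ (-((j : ℝ) * d) / p.toReal) *
          (2 : ℝ≥0∞) ^ (-(((-j : ℤ) : ℝ) * d) / p.toReal)) * (2 : ℝ≥0∞) ^ (((-j : ℤ) : ℝ) * s) *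
          eBesovSupSeminorm s p (f : E → F) volume := by ring
    _ = C * (2 : ℝ≥0∞) ^ (-((j : ℝ) * s)) * eBesovSupSeminorm s p (f : E → F) volume := by
        rw [two_rpow_mul_two_rpow]
        push_cast
        rw [show -((j : ℝ) * d) / p.toReal + -(-(j : ℝ) * d) / p.toReal = 0 by ring,
          ENNReal.rpow_zero, mul_one, show -(j : ℝ) * s = -((j : ℝ) * s) by ring]

/-- **The homogeneous norm through the difference seminorm, abstract form**: if
`‖Δ̇₀ v‖_{L^p} ≤ C [v]_{B^s_{p,∞}}` for every `v ∈ L^p`, then `‖f‖_{Ḃ^s_{p,∞}} ≤ C [f]_{B^s_{p,∞}}`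
for every `f ∈ L^p` (BCD Thm. 2.36, first inequality, `r = ∞`).
[cite: BahouriCheminDanchin2011, Thm. 2.36] -/
theorem eHomBesovNorm_top_coe_le_of_zero {s : ℝ} {p : ℝ≥0∞} [Fact (1 ≤ p)] {C : ℝ≥0∞}
    (hC : ∀ v : Lp F p (volume : Measure E), eLpNormDistrib p (lpBlock 0 (v : 𝓢'(E, F))) ≤
      C * eBesovSupSeminorm s p (v : E → F) volume)
    (f : Lp F p (volume : Measure E)) :
    eHomBesovNorm s p ⊤ (f : 𝓢'(E, F)) ≤ C * eBesovSupSeminorm s p (f : E → F) volume := by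
  rw [eHomBesovNorm_top]
  refine iSup_le fun j => ?_
  calc (2 : ℝ≥0∞) ^ ((j : ℝ) * s) * eLpNormDistrib p (lpBlock j (f : 𝓢'(E, F)))
      ≤ (2 : ℝ≥0∞) ^ ((j : ℝ) * s) * (C * (2 : ℝ≥0∞) ^ (-((j : ℝ) * s)) *
          eBesovSupSeminorm s p (f : E → F) volume) := by
        gcongr
        exact eLpNormDistrib_lpBlock_coe_le_of_zero hC f j
    _ = C * ((2 : ℝ≥0∞) ^ ((j : ℝ) * s) * (2 : ℝ≥0∞) ^ (-((j : ℝ) * s))) *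
          eBesovSupSeminorm s p (f : E → F) volume := by ring
    _ = C * eBesovSupSeminorm s p (f : E → F) volume := by
        rw [two_rpow_mul_two_rpow, add_neg_cancel, ENNReal.rpow_zero, mul_one]

/-- **`‖f‖_{Ḃ^s_{∞,∞}} ≤ C_∞(s) [f]_{B^s_{∞,∞}}`** for `f ∈ L^∞` (BCD Thm. 2.36, first inequality,
`p = r = ∞`): the case excluded from `eHomBesovNorm_top_coe_le_eBesovSupSeminorm`.
[cite: BahouriCheminDanchin2011, Thm. 2.36] -/
theorem eHomBesovNorm_top_top_coe_le (s : ℝ) (f : Lp F ∞ (volume : Measure E)) :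
    eHomBesovNorm s ∞ ⊤ (f : 𝓢'(E, F)) ≤
      (∫⁻ t, ‖(dyadicKernel E) t‖ₑ * ENNReal.ofReal (‖t‖ ^ s)) *
        eBesovSupSeminorm s ∞ (f : E → F) volume :=
  eHomBesovNorm_top_coe_le_of_zero (fun v => eLpNormDistrib_lpBlock_zero_coe_top_le s v) f

/-- **`‖f‖_{Ḃ^s_{p,∞}} ≤ C [f]_{B^s_{p,∞}}` for all `1 ≤ p ≤ ∞`**, `s ≥ 0`, with a finite constant
`C = C(E, s, p)` (BCD Thm. 2.36, first inequality, `r = ∞`; Triebel 1983, §2.5.12, Step 2 of the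
proof): `p < ∞` is `eHomBesovNorm_top_coe_le_eBesovSupSeminorm` (`C = blockDiffConst E s p`),
`p = ∞` is `eHomBesovNorm_top_top_coe_le` (`C = ∫ |k₀(t)| ‖t‖^s dt`, finite by
`lintegral_enorm_mul_ofReal_norm_rpow_lt_top`).
[cite: BahouriCheminDanchin2011, Thm. 2.36] -/
theorem exists_eHomBesovNorm_top_coe_le_eBesovSupSeminorm {s : ℝ} (hs : 0 ≤ s) (p : ℝ≥0∞)
    [Fact (1 ≤ p)] :
    ∃ C : ℝ≥0∞, C ≠ ⊤ ∧ ∀ f : Lp F p (volume : Measure E),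
      eHomBesovNorm s p ⊤ (f : 𝓢'(E, F)) ≤ C * eBesovSupSeminorm s p (f : E → F) volume := by
  by_cases hp : p = ⊤
  · subst hp
    exact ⟨_, (lintegral_enorm_mul_ofReal_norm_rpow_lt_top (dyadicKernel E) hs).ne,
      eHomBesovNorm_top_top_coe_le s⟩
  · exact ⟨blockDiffConst E s p, (blockDiffConst_lt_top hs hp).ne,
      eHomBesovNorm_top_coe_le_eBesovSupSeminorm hp⟩

end TopBlock

/-! ## Differences ⇒ the inhomogeneous class -/

section FromDifferences

variable {E : Type*} [NormedAddCommGroup E] [InnerProductSpace ℝ E] [FiniteDimensional ℝ E]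
  [MeasurableSpace E] [BorelSpace E] {F : Type*} [NormedAddCommGroup F] [NormedSpace ℂ F]
  [CompleteSpace F]

/-- **Differences ⇒ Littlewood–Paley, inhomogeneous form** (Triebel 1983, Thm. 2.5.12, Step 2 /
BCD Thm. 2.36 with Thm. 2.69): an `L^p` function, `1 ≤ p ≤ ∞`, with finite difference seminorm of
order `s ≥ 0` lies in `B^s_{p,∞}`: `Ṡ₀ f ∈ L^p` (Young) and
`sup_{j ≥ 1} 2^{js} ‖Δ̇_j f‖_{L^p} ≤ ‖f‖_{Ḃ^s_{p,∞}} ≤ C [f]_{B^s_{p,∞}} < ∞`. No realisation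
condition and no restriction on the dimension or on `p` is involved.
[cite: TriebelTFS1983, §2.5.12 Thm. Step 2] -/
theorem memBesov_top_coe_of_memBesovSup {s : ℝ} (hs : 0 ≤ s) {p : ℝ≥0∞} [Fact (1 ≤ p)]
    (f : Lp F p (volume : Measure E)) (hf : MemBesovSup s p (f : E → F) volume) :
    MemBesov s p ∞ (f : 𝓢'(E, F)) := by
  obtain ⟨C, hC, hle⟩ := exists_eHomBesovNorm_top_coe_le_eBesovSupSeminorm (E := E) (F := F) hs p
  have hhom : eHomBesovNorm s p ⊤ (f : 𝓢'(E, F)) < ⊤ :=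
    (hle f).trans_lt (ENNReal.mul_lt_top hC.lt_top hf.2)
  exact ENNReal.add_lt_top.2 ⟨eLpNormDistrib_lowFreqCutoff_coe_lt_top 0 f,
    (eLpNorm_lpBlockWeightSucc_le_eHomBesovNorm s p ⊤ _).trans_lt hhom⟩

end FromDifferences

/-! ## Translation is Lipschitz in `L¹` on Schwartz functions -/

section SchwartzTranslation

variable {E : Type*} [NormedAddCommGroup E] [InnerProductSpace ℝ E] [FiniteDimensional ℝ E]
  [MeasurableSpace E] [BorelSpace E]

/-- **`‖θ(· + h) - θ‖_{L¹} ≤ K ‖h‖` for `‖h‖ ≤ 1`**, `θ` a Schwartz function, with `K < ∞` depending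
on `θ` only: by the mean value inequality on the unit ball around `x`,
`‖θ(x + h) - θ(x)‖ ≤ ‖h‖ sup_{‖y - x‖ ≤ 1} ‖∇θ(y)‖ ≤ 4^{d+1} S (1 + ‖x‖)^{-(d+1)} ‖h‖`
(Schwartz decay of `∇θ`, `SchwartzMap.one_add_le_sup_seminorm_apply`, and Peetre
`1 + ‖x‖ ≤ 2(1 + ‖y‖)`), and `(1 + ‖x‖)^{-(d+1)}` is integrable (`finite_integral_one_add_norm`).
[folklore] -/
theorem exists_eLpNorm_translate_sub_le (θ : 𝓢(E, ℂ)) :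
    ∃ K : ℝ≥0∞, K ≠ ⊤ ∧ ∀ h : E, ‖h‖ ≤ 1 →
      eLpNorm (fun x => θ (x + h) - θ x) 1 (volume : Measure E) ≤ ENNReal.ofReal ‖h‖ * K := by
  set d : ℕ := Module.finrank ℝ E with hd
  set θ' : 𝓢(E, E →L[ℝ] ℂ) := SchwartzMap.fderivCLM ℝ E ℂ θ with hθ'
  set S : ℝ :=
    2 ^ (d + 1) * (Finset.Iic (d + 1, 0)).sup (fun m => SchwartzMap.seminorm ℝ m.1 m.2) θ' with hS
  have hS0 : 0 ≤ S := by positivity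
  have hdec : ∀ y : E, (1 + ‖y‖) ^ (d + 1) * ‖fderiv ℝ θ y‖ ≤ S := fun y => by
    have h := SchwartzMap.one_add_le_sup_seminorm_apply (𝕜 := ℝ) (m := (d + 1, 0)) (k := d + 1)
      (n := 0) le_rfl le_rfl θ' y
    rwa [norm_iteratedFDeriv_zero, hθ', SchwartzMap.fderivCLM_apply] at h
  set I : ℝ≥0∞ := ∫⁻ x : E, ENNReal.ofReal ((1 + ‖x‖) ^ (-((d : ℝ) + 1))) with hI
  have hItop : I < ⊤ := finite_integral_one_add_norm (by rw [hd]; linarith)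
  refine ⟨ENNReal.ofReal (2 ^ (d + 1) * S) * I, ENNReal.mul_ne_top ENNReal.ofReal_ne_top hItop.ne,
    fun h hh => ?_⟩
  -- pointwise mean-value bound
  have hpt : ∀ x : E,
      ‖θ (x + h) - θ x‖ ≤ (2 ^ (d + 1) * S * (1 + ‖x‖) ^ (-((d : ℝ) + 1))) * ‖h‖ := by
    intro x
    have hx0 : 0 < 1 + ‖x‖ := by positivity
    have hball : ∀ y ∈ Metric.closedBall x 1,
        ‖fderiv ℝ θ y‖ ≤ 2 ^ (d + 1) * S * (1 + ‖x‖) ^ (-((d : ℝ) + 1)) := by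
      intro y hy
      rw [Metric.mem_closedBall, dist_eq_norm] at hy
      have hy0 : 0 < 1 + ‖y‖ := by positivity
      have hxy : 1 + ‖x‖ ≤ 2 * (1 + ‖y‖) := by
        have : ‖x‖ ≤ ‖y‖ + ‖y - x‖ := by
          calc ‖x‖ = ‖y - (y - x)‖ := by rw [sub_sub_cancel]
            _ ≤ ‖y‖ + ‖y - x‖ := norm_sub_le _ _
        linarith [norm_nonneg y]
      have h1 : ‖fderiv ℝ θ y‖ ≤ S * ((1 + ‖y‖) ^ (d + 1))⁻¹ := by
        rw [le_mul_inv_iff₀ (pow_pos hy0 _), mul_comm]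
        exact hdec y
      have h2 : ((1 + ‖y‖) ^ (d + 1))⁻¹ ≤ 2 ^ (d + 1) * ((1 + ‖x‖) ^ (d + 1))⁻¹ := by
        rw [inv_le_iff_one_le_mul₀ (pow_pos hy0 _)]
        calc (1 : ℝ) = ((1 + ‖x‖) ^ (d + 1))⁻¹ * (1 + ‖x‖) ^ (d + 1) := by
              rw [inv_mul_cancel₀ (pow_ne_zero _ hx0.ne')]
          _ ≤ ((1 + ‖x‖) ^ (d + 1))⁻¹ * (2 * (1 + ‖y‖)) ^ (d + 1) := by gcongr
          _ = 2 ^ (d + 1) * ((1 + ‖x‖) ^ (d + 1))⁻¹ * (1 + ‖y‖) ^ (d + 1) := by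
              rw [mul_pow]; ring
      have h3 : ((1 + ‖x‖) ^ (d + 1))⁻¹ = (1 + ‖x‖) ^ (-((d : ℝ) + 1)) := by
        rw [Real.rpow_neg hx0.le, ← Real.rpow_natCast, Nat.cast_add, Nat.cast_one]
      calc ‖fderiv ℝ θ y‖ ≤ S * ((1 + ‖y‖) ^ (d + 1))⁻¹ := h1
        _ ≤ S * (2 ^ (d + 1) * ((1 + ‖x‖) ^ (d + 1))⁻¹) := mul_le_mul_of_nonneg_left h2 hS0
        _ = 2 ^ (d + 1) * S * (1 + ‖x‖) ^ (-((d : ℝ) + 1)) := by rw [h3]; ring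
    have hmv := (convex_closedBall x 1).norm_image_sub_le_of_norm_fderiv_le (𝕜 := ℝ)
      (f := (θ : E → ℂ)) (fun y _ => θ.differentiableAt) hball
      (Metric.mem_closedBall_self zero_le_one)
      (show x + h ∈ Metric.closedBall x 1 by
        rw [Metric.mem_closedBall, dist_eq_norm, add_sub_cancel_left]; exact hh)
    rwa [add_sub_cancel_left] at hmv
  -- integrate
  calc eLpNorm (fun x => θ (x + h) - θ x) 1 volume = ∫⁻ x, ‖θ (x + h) - θ x‖ₑ :=
        eLpNorm_one_eq_lintegral_enorm
    _ ≤ ∫⁻ x, ENNReal.ofReal ((2 ^ (d + 1) * S * (1 + ‖x‖) ^ (-((d : ℝ) + 1))) * ‖h‖) := by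
        refine lintegral_mono fun x => ?_
        rw [← ofReal_norm]
        exact ENNReal.ofReal_le_ofReal (hpt x)
    _ = ENNReal.ofReal ‖h‖ * (ENNReal.ofReal (2 ^ (d + 1) * S) * I) := by
        rw [hI, ← lintegral_const_mul' _ _ ENNReal.ofReal_ne_top,
          ← lintegral_const_mul' _ _ ENNReal.ofReal_ne_top]
        refine lintegral_congr fun x => ?_
        rw [← ENNReal.ofReal_mul (by positivity), ← ENNReal.ofReal_mul (by positivity)]
        congr 1
        ring

end SchwartzTranslation

/-! ## The low frequencies: `Ṡ₀ f ∈ B^s_{p,∞}` for `0 ≤ s ≤ 1` -/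

section LowFreqDifference

variable {E : Type*} [NormedAddCommGroup E] [InnerProductSpace ℝ E] [FiniteDimensional ℝ E]

/-- The symbol of the low-frequency difference `τ_h Ṡ₀ - Ṡ₀` is the Schwartz function
`Ψ_h = (e_h - 1) • χ` (`e_h(ξ) = e^{2πi⟨ξ,h⟩}`, `χ` the dyadic cut-off); as a function,
`Ψ_h = χ · (e_h - 1)`. [folklore] -/
theorem coe_smulLeftCLM_translSymbol_sub_one_lowFreq (h : E) :
    ((SchwartzMap.smulLeftCLM ℂ (fun ξ : E => translSymbol h ξ - 1) (lowFreqSymbolSchwartz E 0) :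
      𝓢(E, ℂ)) : E → ℂ) = lowFreqSymbol 0 * fun ξ : E => translSymbol h ξ - 1 := by
  funext ξ
  rw [SchwartzMap.smulLeftCLM_apply_apply (hasTemperateGrowth_translSymbol_sub_one h)]
  simp only [coe_lowFreqSymbolSchwartz, smul_eq_mul, Pi.mul_apply]
  ring

/-- `Ψ_h = e_h χ - χ` in `𝓢(E, ℂ)`. [folklore] -/
theorem smulLeftCLM_translSymbol_sub_one_lowFreq_eq_sub (h : E) :
    (SchwartzMap.smulLeftCLM ℂ (fun ξ : E => translSymbol h ξ - 1) (lowFreqSymbolSchwartz E 0) :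
      𝓢(E, ℂ)) =
      SchwartzMap.smulLeftCLM ℂ (translSymbol h) (lowFreqSymbolSchwartz E 0) -
        lowFreqSymbolSchwartz E 0 := by
  ext ξ
  rw [sub_apply, SchwartzMap.smulLeftCLM_apply_apply (hasTemperateGrowth_translSymbol_sub_one h),
    SchwartzMap.smulLeftCLM_apply_apply (hasTemperateGrowth_translSymbol h), sub_smul, one_smul]

variable [MeasurableSpace E] [BorelSpace E]

/-- **Modulation is translation under `𝓕⁻¹`**: `𝓕⁻¹(e_h θ)(x) = (𝓕⁻¹θ)(x + h)` for Schwartz `θ`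
(BCD §1.2). [folklore] -/
theorem fourierInv_smulLeftCLM_translSymbol_apply (h : E) (θ : 𝓢(E, ℂ)) (x : E) :
    ((𝓕⁻ (SchwartzMap.smulLeftCLM ℂ (translSymbol h) θ) : 𝓢(E, ℂ)) : E → ℂ) x =
      ((𝓕⁻ θ : 𝓢(E, ℂ)) : E → ℂ) (x + h) := by
  rw [fourierInv_apply_eq_fourier_neg, fourierInv_apply_eq_fourier_neg,
    fourier_smulLeftCLM_translSymbol_apply, neg_add', sub_eq_add_neg]

/-- **The kernel of the low-frequency difference**: `𝓕⁻¹Ψ_h = κ₀(· + h) - κ₀ = τ_h κ₀ - κ₀`,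
`κ₀ = 𝓕⁻¹χ` (`Literature.Analysis.FunctionSpaces.lowFreqZeroKernel`). [folklore] -/
theorem fourierInv_smulLeftCLM_translSymbol_sub_one_lowFreq_apply (h x : E) :
    ((𝓕⁻ (SchwartzMap.smulLeftCLM ℂ (fun ξ : E => translSymbol h ξ - 1)
      (lowFreqSymbolSchwartz E 0)) : 𝓢(E, ℂ)) : E → ℂ) x =
      lowFreqZeroKernel E (x + h) - lowFreqZeroKernel E x := by
  rw [smulLeftCLM_translSymbol_sub_one_lowFreq_eq_sub, sub_eq_add_neg,
    FourierTransform.fourierInv_add, FourierTransform.fourierInv_neg, ← sub_eq_add_neg, sub_apply,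
    fourierInv_smulLeftCLM_translSymbol_apply]
  rfl

variable {F : Type*} [NormedAddCommGroup F] [NormedSpace ℂ F]

/-- `(e_h - 1)(D) Ṡ₀ = Ψ_h(D)` on `𝓢'(E, F)` (composition of Fourier multipliers). [folklore] -/
theorem fourierMultiplierCLM_translSymbol_sub_one_lowFreqCutoff_zero (h : E) (u : 𝓢'(E, F)) :
    fourierMultiplierCLM F (fun ξ : E => translSymbol h ξ - 1) (lowFreqCutoff 0 u) =
      fourierMultiplierCLM F (⇑(SchwartzMap.smulLeftCLM ℂ (fun ξ : E => translSymbol h ξ - 1)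
        (lowFreqSymbolSchwartz E 0) : 𝓢(E, ℂ))) u := by
  rw [lowFreqCutoff_apply, TemperedDistribution.fourierMultiplierCLM_fourierMultiplierCLM_apply
    (hasTemperateGrowth_lowFreqSymbol 0) (hasTemperateGrowth_translSymbol_sub_one h),
    coe_smulLeftCLM_translSymbol_sub_one_lowFreq]

variable [CompleteSpace F]

/-- **The low-frequency difference bound**: there is `K < ∞` with
`‖(e_h - 1)(D) Ṡ₀ f‖_{L^p} ≤ K ‖h‖ ‖f‖_{L^p}` for all `f ∈ L^p`, `1 ≤ p ≤ ∞`, `‖h‖ ≤ 1`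
(`(e_h - 1)(D) Ṡ₀ f = Ψ_h(D) f = (τ_h κ₀ - κ₀) ⋆ f`, Young's inequality
`eLpNormDistrib_fourierMultiplierCLM_coe_le`, and `‖τ_h κ₀ - κ₀‖_{L¹} ≤ K ‖h‖`,
`exists_eLpNorm_translate_sub_le`). [folklore] -/
theorem exists_eLpNormDistrib_translSymbol_sub_one_lowFreqCutoff_le (p : ℝ≥0∞) [Fact (1 ≤ p)] :
    ∃ K : ℝ≥0∞, K ≠ ⊤ ∧ ∀ h : E, ‖h‖ ≤ 1 → ∀ f : Lp F p (volume : Measure E),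
      eLpNormDistrib p (fourierMultiplierCLM F (fun ξ : E => translSymbol h ξ - 1)
        (lowFreqCutoff 0 (f : 𝓢'(E, F)))) ≤ ENNReal.ofReal ‖h‖ * K * ‖f‖ₑ := by
  obtain ⟨K, hK, hle⟩ := exists_eLpNorm_translate_sub_le (lowFreqZeroKernel E)
  refine ⟨K, hK, fun h hh f => ?_⟩
  rw [fourierMultiplierCLM_translSymbol_sub_one_lowFreqCutoff_zero]
  refine (eLpNormDistrib_fourierMultiplierCLM_coe_le _ f).trans ?_
  gcongr
  have hker : ((𝓕⁻ (SchwartzMap.smulLeftCLM ℂ (fun ξ : E => translSymbol h ξ - 1)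
      (lowFreqSymbolSchwartz E 0)) : 𝓢(E, ℂ)) : E → ℂ) =
      fun x => lowFreqZeroKernel E (x + h) - lowFreqZeroKernel E x :=
    funext (fourierInv_smulLeftCLM_translSymbol_sub_one_lowFreq_apply h)
  rw [hker]
  exact hle h hh

/-- **The low-frequency part of an `L^p` function lies in every `B^s_{p,∞}`, `0 ≤ s ≤ 1`**
(`1 ≤ p ≤ ∞`; Triebel 1983, proof of Thm. 2.5.12, Step 1, the term `j = 0`): if `g₀ ∈ L^p`
represents `Ṡ₀ f`, then `‖τ_h g₀ - g₀‖_{L^p} ≤ K ‖h‖ ‖f‖_{L^p} ≤ K ‖f‖_{L^p} ‖h‖^s` for `‖h‖ ≤ 1`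
and `‖τ_h g₀ - g₀‖_{L^p} ≤ 2‖g₀‖_{L^p} ≤ 2‖g₀‖_{L^p} ‖h‖^s` for `‖h‖ ≥ 1`, so
`[g₀]_{B^s_{p,∞}} ≤ K ‖f‖_{L^p} + 2 ‖g₀‖_{L^p} < ∞`. [cite: TriebelTFS1983, §2.5.12 Thm. Step 1] -/
theorem memBesovSup_lowFreqCutoff_zero_coe {s : ℝ} (hs0 : 0 ≤ s) (hs1 : s ≤ 1) {p : ℝ≥0∞}
    [Fact (1 ≤ p)] (f g₀ : Lp F p (volume : Measure E))
    (hg₀ : (g₀ : 𝓢'(E, F)) = lowFreqCutoff 0 (f : 𝓢'(E, F))) :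
    MemBesovSup s p (g₀ : E → F) volume := by
  obtain ⟨K, hK, hle⟩ :=
    exists_eLpNormDistrib_translSymbol_sub_one_lowFreqCutoff_le (E := E) (F := F) p
  refine ⟨Lp.memLp g₀, ?_⟩
  have hbound : eBesovSupSeminorm s p (g₀ : E → F) volume ≤ K * ‖f‖ₑ + 2 * ‖g₀‖ₑ := by
    refine iSup₂_le fun h hh => ?_
    rw [eDiffQuotient_def]
    have hdiff : eLpNorm (fun x => (g₀ : E → F) (x + h) - (g₀ : E → F) x) p volume =
        eLpNormDistrib p (fourierMultiplierCLM F (fun ξ : E => translSymbol h ξ - 1)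
          (g₀ : 𝓢'(E, F))) := by
      rw [fourierMultiplierCLM_translSymbol_sub_one_coe, eLpNormDistrib_coe, enorm_lpTranslate_sub]
    rw [hdiff]
    rcases le_or_gt ‖h‖ 1 with hh1 | hh1
    · -- small increments
      have h1 := hle h hh1 f
      rw [← hg₀] at h1
      refine ENNReal.div_le_of_le_mul (h1.trans ?_)
      have hhs : ‖h‖ ≤ ‖h‖ ^ s := Real.self_le_rpow_of_le_one (norm_nonneg _) hh1 hs1
      calc ENNReal.ofReal ‖h‖ * K * ‖f‖ₑ ≤ ENNReal.ofReal (‖h‖ ^ s) * K * ‖f‖ₑ := by gcongr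
        _ = K * ‖f‖ₑ * ENNReal.ofReal (‖h‖ ^ s) := by ring
        _ ≤ (K * ‖f‖ₑ + 2 * ‖g₀‖ₑ) * ENNReal.ofReal (‖h‖ ^ s) := by
            gcongr
            exact le_self_add
    · -- large increments
      have h2 : eLpNormDistrib p (fourierMultiplierCLM F (fun ξ : E => translSymbol h ξ - 1)
          (g₀ : 𝓢'(E, F))) ≤ 2 * ‖g₀‖ₑ := by
        have h' := eLpNormDistrib_translSymbol_sub_one_le_two_mul (p := p) h (g₀ : 𝓢'(E, F))
        rwa [eLpNormDistrib_coe] at h'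
      refine ENNReal.div_le_of_le_mul (h2.trans ?_)
      have hhs : (1 : ℝ≥0∞) ≤ ENNReal.ofReal (‖h‖ ^ s) := by
        rw [← ENNReal.ofReal_one]
        exact ENNReal.ofReal_le_ofReal (Real.one_le_rpow hh1.le hs0)
      calc 2 * ‖g₀‖ₑ = 2 * ‖g₀‖ₑ * 1 := (mul_one _).symm
        _ ≤ (K * ‖f‖ₑ + 2 * ‖g₀‖ₑ) * ENNReal.ofReal (‖h‖ ^ s) := by
            gcongr
            exact le_add_self
  refine hbound.trans_lt (ENNReal.add_lt_top.2 ⟨?_, ?_⟩)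
  · exact ENNReal.mul_lt_top hK.lt_top enorm_lt_top
  · exact ENNReal.mul_lt_top ENNReal.ofNat_lt_top enorm_lt_top

end LowFreqDifference

/-! ## Littlewood–Paley ⇒ differences: the high frequencies `f - Ṡ₀ f ∈ Ḃ^s_{p,∞} ∩ 𝓢'_h` -/

section ToDifferences

variable {E : Type*} [NormedAddCommGroup E] [InnerProductSpace ℝ E] [FiniteDimensional ℝ E]
  [MeasurableSpace E] [BorelSpace E] {F : Type*} [NormedAddCommGroup F] [NormedSpace ℂ F]

omit [FiniteDimensional ℝ E] [MeasurableSpace E] [BorelSpace E] in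
/-- `χ(ξ) χ(2^{-j} ξ) = χ(2^{-j} ξ)` for `j ≤ -1`: on the support `‖ξ‖ < 2^{j+1} ≤ 1` of the second
factor the first one is `1`. [folklore] -/
theorem lowFreqSymbol_zero_mul_lowFreqSymbol_of_le {j : ℤ} (hj : j ≤ -1) :
    (lowFreqSymbol (E := E) 0) * lowFreqSymbol j = lowFreqSymbol j := by
  funext ξ
  simp only [Pi.mul_apply]
  rcases le_or_gt ‖ξ‖ 1 with hξ | hξ
  · rw [lowFreqSymbol_eq_one_of_norm_le (j := 0) (by simpa using hξ), one_mul]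
  · have hzero : lowFreqSymbol j ξ = 0 := by
      simp only [lowFreqSymbol]
      rw [dyadicCutoff_apply_of_two_le_norm, Complex.ofReal_zero]
      rw [norm_two_zpow_smul]
      have h2 : (2 : ℝ) ≤ (2 : ℝ) ^ (-j) := by
        calc (2 : ℝ) = 2 ^ (1 : ℤ) := (zpow_one 2).symm
          _ ≤ 2 ^ (-j) := zpow_le_zpow_right₀ one_le_two (by omega)
      nlinarith
    rw [hzero, mul_zero]

/-- **`Ṡ_j Ṡ₀ = Ṡ_j` for `j ≤ -1`** on `𝓢'(E, F)` (the symbols multiply,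
`lowFreqSymbol_zero_mul_lowFreqSymbol_of_le`). [folklore] -/
theorem lowFreqCutoff_lowFreqCutoff_zero_of_le {j : ℤ} (hj : j ≤ -1) (u : 𝓢'(E, F)) :
    lowFreqCutoff j (lowFreqCutoff 0 u) = lowFreqCutoff j u := by
  rw [lowFreqCutoff_apply, lowFreqCutoff_apply, lowFreqCutoff_apply,
    TemperedDistribution.fourierMultiplierCLM_fourierMultiplierCLM_apply
      (hasTemperateGrowth_lowFreqSymbol 0) (hasTemperateGrowth_lowFreqSymbol j),
    lowFreqSymbol_zero_mul_lowFreqSymbol_of_le hj]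

/-- `Δ̇_j Ṡ₀ = Ṡ₀ Δ̇_j` (Fourier multipliers commute). [folklore] -/
theorem lpBlock_lowFreqCutoff_zero_comm (j : ℤ) (u : 𝓢'(E, F)) :
    lpBlock j (lowFreqCutoff 0 u) = lowFreqCutoff 0 (lpBlock j u) := by
  rw [lpBlock_apply, lpBlock_apply, lowFreqCutoff_apply, lowFreqCutoff_apply,
    TemperedDistribution.fourierMultiplierCLM_fourierMultiplierCLM_apply
      (hasTemperateGrowth_lowFreqSymbol 0) (hasTemperateGrowth_dyadicSymbol j),
    TemperedDistribution.fourierMultiplierCLM_fourierMultiplierCLM_apply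
      (hasTemperateGrowth_dyadicSymbol j) (hasTemperateGrowth_lowFreqSymbol 0), mul_comm]

variable [CompleteSpace F]

/-- **The high-frequency part of an `L^p` function with finite `B^s_{p,∞}` norm lies in
`Ḃ^s_{p,∞}`**, `s ≥ 0`, `1 ≤ p ≤ ∞`, any dimension: for `g₀ ∈ L^p` representing `Ṡ₀ f` and
`g = f - g₀`, (i) `Ṡ_j g = Ṡ_j f - Ṡ_j Ṡ₀ f = 0` for `j ≤ -1`
(`lowFreqCutoff_lowFreqCutoff_zero_of_le`), so the realisation condition holds; (ii)
`‖Δ̇_j g‖_{L^p} ≤ (1 + M) ‖Δ̇_j f‖_{L^p}` (`Δ̇_j Ṡ₀ = Ṡ₀ Δ̇_j`, `‖Ṡ₀‖ ≤ M`) gives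
`2^{js} ‖Δ̇_j g‖ ≤ (1 + M) sup_{j ≥ 1} 2^{js} ‖Δ̇_j f‖` for `j ≥ 1`, while for `j ≤ 0`,
`2^{js} ‖Δ̇_j g‖ ≤ 2M ‖g‖_{L^p}` (`eLpNormDistrib_lpBlock_le_two_mul`). (Triebel 1983, proof of
Thm. 2.5.12, Step 1, split `f = Ṡ₀ f + ∑_{j ≥ 1} Δ̇_j f`.)
[cite: TriebelTFS1983, §2.5.12 Thm. Step 1] -/
theorem memHomBesov_top_coe_sub_lowFreqCutoff {s : ℝ} (hs : 0 ≤ s) {p : ℝ≥0∞} [Fact (1 ≤ p)]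
    (f g₀ : Lp F p (volume : Measure E)) (hg₀ : (g₀ : 𝓢'(E, F)) = lowFreqCutoff 0 (f : 𝓢'(E, F)))
    (hf : MemBesov s p ∞ (f : 𝓢'(E, F))) :
    MemHomBesov s p ∞ (((f - g₀ : Lp F p (volume : Measure E))) : 𝓢'(E, F)) := by
  set M : ℝ≥0∞ := lowFreqOpNormBound E with hM
  set N : ℝ≥0∞ := eLpNorm (lpBlockWeightSucc s p (f : 𝓢'(E, F))) ∞ Measure.count with hN
  have hNtop : N < ⊤ := (ENNReal.add_lt_top.1 hf).2
  set g : Lp F p (volume : Measure E) := f - g₀ with hg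
  have hgdist : (g : 𝓢'(E, F)) = (f : 𝓢'(E, F)) - lowFreqCutoff 0 (f : 𝓢'(E, F)) := by
    rw [← hg₀, hg, ← Lp.toTemperedDistributionCLM_apply, ← Lp.toTemperedDistributionCLM_apply,
      ← Lp.toTemperedDistributionCLM_apply, map_sub]
  have hNj : ∀ n : ℕ, lpBlockWeightSucc s p (f : 𝓢'(E, F)) n ≤ N := fun n => by
    rw [hN, eLpNorm_exponent_top, eLpNormEssSup_count]
    calc lpBlockWeightSucc s p (f : 𝓢'(E, F)) n = ‖lpBlockWeightSucc s p (f : 𝓢'(E, F)) n‖ₑ :=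
          (enorm_eq_self _).symm
      _ ≤ ⨆ i, ‖lpBlockWeightSucc s p (f : 𝓢'(E, F)) i‖ₑ :=
          le_iSup (fun i => ‖lpBlockWeightSucc s p (f : 𝓢'(E, F)) i‖ₑ) n
  -- blockwise comparison `‖Δ̇_j g‖ ≤ (1 + M) ‖Δ̇_j f‖`
  have hblock : ∀ j : ℤ, eLpNormDistrib p (lpBlock j (g : 𝓢'(E, F))) ≤
      (1 + M) * eLpNormDistrib p (lpBlock j (f : 𝓢'(E, F))) := fun j => by
    rw [hgdist, map_sub, lpBlock_lowFreqCutoff_zero_comm]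
    calc eLpNormDistrib p (lpBlock j (f : 𝓢'(E, F)) - lowFreqCutoff 0 (lpBlock j (f : 𝓢'(E, F))))
        ≤ eLpNormDistrib p (lpBlock j (f : 𝓢'(E, F))) +
            eLpNormDistrib p (lowFreqCutoff 0 (lpBlock j (f : 𝓢'(E, F)))) :=
          eLpNormDistrib_sub_le _ _
      _ ≤ eLpNormDistrib p (lpBlock j (f : 𝓢'(E, F))) +
            M * eLpNormDistrib p (lpBlock j (f : 𝓢'(E, F))) := by
          gcongr
          exact eLpNormDistrib_lowFreqCutoff_zero_le _
      _ = (1 + M) * eLpNormDistrib p (lpBlock j (f : 𝓢'(E, F))) := by ring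
  refine ⟨?_, ?_⟩
  · -- the homogeneous norm of `g` is finite
    have hfin : (1 + M) * N + 2 * M * ‖g‖ₑ < ⊤ := by
      refine ENNReal.add_lt_top.2 ⟨ENNReal.mul_lt_top (ENNReal.add_lt_top.2
        ⟨ENNReal.one_lt_top, lowFreqOpNormBound_lt_top⟩) hNtop, ?_⟩
      exact ENNReal.mul_lt_top (ENNReal.mul_lt_top ENNReal.ofNat_lt_top lowFreqOpNormBound_lt_top)
        enorm_lt_top
    refine lt_of_le_of_lt ?_ hfin
    rw [eHomBesovNorm_top]
    refine iSup_le fun j => ?_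
    rcases le_or_gt j 0 with hj | hj
    · -- low frequencies: `2^{js} ≤ 1` and `‖Δ̇_j g‖ ≤ 2M ‖g‖`
      have h2 : (2 : ℝ≥0∞) ^ ((j : ℝ) * s) ≤ 1 := by
        have hjs : (j : ℝ) * s ≤ 0 := mul_nonpos_of_nonpos_of_nonneg (by exact_mod_cast hj) hs
        exact (ENNReal.rpow_le_rpow_of_exponent_le one_le_two hjs).trans_eq ENNReal.rpow_zero
      have h3 : eLpNormDistrib p (lpBlock j (g : 𝓢'(E, F))) ≤ 2 * M * ‖g‖ₑ := by
        have h' := eLpNormDistrib_lpBlock_le_two_mul (p := p) j (g : 𝓢'(E, F))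
        rwa [eLpNormDistrib_coe] at h'
      calc (2 : ℝ≥0∞) ^ ((j : ℝ) * s) * eLpNormDistrib p (lpBlock j (g : 𝓢'(E, F)))
          ≤ 1 * (2 * M * ‖g‖ₑ) := mul_le_mul' h2 h3
        _ = 2 * M * ‖g‖ₑ := one_mul _
        _ ≤ (1 + M) * N + 2 * M * ‖g‖ₑ := le_add_self
    · -- high frequencies: `j = n + 1`
      obtain ⟨n, rfl⟩ : ∃ n : ℕ, j = (n : ℤ) + 1 := ⟨(j - 1).toNat, by omega⟩
      calc (2 : ℝ≥0∞) ^ ((((n : ℤ) + 1 : ℤ) : ℝ) * s) *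
            eLpNormDistrib p (lpBlock ((n : ℤ) + 1) (g : 𝓢'(E, F)))
          ≤ (2 : ℝ≥0∞) ^ ((((n : ℤ) + 1 : ℤ) : ℝ) * s) *
              ((1 + M) * eLpNormDistrib p (lpBlock ((n : ℤ) + 1) (f : 𝓢'(E, F)))) := by
            gcongr
            exact hblock _
        _ = (1 + M) * lpBlockWeightSucc s p (f : 𝓢'(E, F)) n := by
            rw [lpBlockWeightSucc, lpBlockWeight]
            ring
        _ ≤ (1 + M) * N := by
            gcongr
            exact hNj n
        _ ≤ (1 + M) * N + 2 * M * ‖g‖ₑ := le_self_add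
  · -- the realisation condition: `Ṡ_j g = 0` for `j ≤ -1`
    have hev : ∀ᶠ j in atBot, (0 : 𝓢'(E, F)) = lowFreqCutoff j (g : 𝓢'(E, F)) := by
      filter_upwards [eventually_le_atBot (-1 : ℤ)] with j hj
      rw [hgdist, map_sub, lowFreqCutoff_lowFreqCutoff_zero_of_le hj, sub_self]
    exact tendsto_const_nhds.congr' hev

/-- **Littlewood–Paley ⇒ differences, inhomogeneous form** (Triebel 1983, Thm. 2.5.12, Step 1 /
BCD Thm. 2.36, second inequality, with Thm. 2.69): an `L^p` function (`1 ≤ p ≤ ∞`, any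
dimension) with finite inhomogeneous `B^s_{p,∞}` norm, `0 < s < 1`, has finite difference seminorm
of order `s`: `f = (f - Ṡ₀ f) + Ṡ₀ f` with `f - Ṡ₀ f ∈ Ḃ^s_{p,∞} ∩ 𝓢'_h ∩ L^p`
(`memHomBesov_top_coe_sub_lowFreqCutoff`, then the homogeneous theorem
`memBesovSup_coe_of_memHomBesov_top`) and `Ṡ₀ f ∈ B^s_{p,∞}`
(`memBesovSup_lowFreqCutoff_zero_coe`), and `B^s_{p,∞}(volume)` is a linear space
(`MemBesovSup.add'`). [cite: TriebelTFS1983, §2.5.12 Thm. Step 1] -/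
theorem memBesovSup_coe_of_memBesov_top {s : ℝ} (hs₀ : 0 < s) (hs₁ : s < 1) {p : ℝ≥0∞}
    [Fact (1 ≤ p)] (f : Lp F p (volume : Measure E)) (hf : MemBesov s p ∞ (f : 𝓢'(E, F))) :
    MemBesovSup s p (f : E → F) volume := by
  obtain ⟨g₀, hg₀⟩ := exists_coe_eq_of_eLpNormDistrib_lt_top
    (eLpNormDistrib_lowFreqCutoff_coe_lt_top 0 f)
  have h1 : MemBesovSup s p ((f - g₀ : Lp F p (volume : Measure E)) : E → F) volume :=
    memBesovSup_coe_of_memHomBesov_top hs₀ hs₁ (f - g₀)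
      (memHomBesov_top_coe_sub_lowFreqCutoff hs₀.le f g₀ hg₀ hf)
  have h2 : MemBesovSup s p (g₀ : E → F) volume :=
    memBesovSup_lowFreqCutoff_zero_coe hs₀.le hs₁.le f g₀ hg₀
  have hae : ((f - g₀ : Lp F p (volume : Measure E)) : E → F) + (g₀ : E → F) =ᵐ[volume]
      (f : E → F) := by
    filter_upwards [Lp.coeFn_sub f g₀] with x hx
    rw [Pi.add_apply, hx, Pi.sub_apply, sub_add_cancel]
  exact (h1.add' h2).ae_eq hae

end ToDifferences

/-! ## The characterisation -/

section Characterisation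

variable {E : Type*} [NormedAddCommGroup E] [InnerProductSpace ℝ E] [FiniteDimensional ℝ E]
  [MeasurableSpace E] [BorelSpace E] {F : Type*} [NormedAddCommGroup F] [NormedSpace ℂ F]
  [CompleteSpace F]

/-- **Discharge of the named fact `memBesov_top_iff_memBesovSup`** — the finite-difference
characterisation of the inhomogeneous Nikol'skii–Besov space `B^s_{p,∞}`, `0 < s < 1`,
`1 ≤ p ≤ ∞`: for `f ∈ L^p(E; F)`,
`f ∈ B^s_{p,∞}` (finite `‖Ṡ₀ f‖_{L^p} + sup_{j ≥ 1} 2^{js} ‖Δ̇_j f‖_{L^p}`) iff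
`sup_{h ≠ 0} ‖f(· + h) - f‖_{L^p} / ‖h‖^s < ∞`. Source: Triebel, *Theory of Function Spaces*
(1983), §2.5.12, Theorem — for `0 < p ≤ ∞`, `0 < q ≤ ∞`, `s > σ̃_p`, `M > s`, the quasi-norm
`‖f | L_p‖ + (∫ |h|^{-sq} ‖Δ^M_h f | L_p‖^q dh/|h|^n)^{1/q}` ("modification if `q = ∞`") is an
equivalent quasi-norm on `B^s_{p,q}(ℝⁿ)` — together with its Remark 3 ("`f ∈ B^s_{p,q}(R_n)` if and
only if `f ∈ L_p(R_n)` and `‖f | B^s_{p,q}(R_n)‖^{(2)}_M < ∞`"); here `1 ≤ p ≤ ∞` (`σ̃_p = 0`),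
`q = ∞`, `M = 1`. Equivalently BCD Thm. 2.36 (homogeneous difference characterisation) with
Thm. 2.69 (`B^s = L^p ∩ Ḃ^s`, `s > 0`). Proved in every dimension, including `E = {0}` where both
sides hold for every `L^p` function (`Ṡ_j = id`, `Δ̇_j = 0`, no increment `h ≠ 0`), and for every
`1 ≤ p ≤ ∞`: the two directions are `memBesovSup_coe_of_memBesov_top` and
`memBesov_top_coe_of_memBesovSup`. [cite: TriebelTFS1983, §2.5.12 Thm. eq. (4) and Rem. 3]
[cite: Triebel1983, Thm. 2.5.12] [cite: BahouriCheminDanchin2011, Thm. 2.36 and Thm. 2.69] -/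
theorem memBesov_top_iff_memBesovSup_holds : memBesov_top_iff_memBesovSup (E := E) (F := F) := by
  intro s hs₀ hs₁ p _ f
  exact ⟨memBesovSup_coe_of_memBesov_top hs₀ hs₁ f, memBesov_top_coe_of_memBesovSup hs₀.le f⟩

end Characterisation

end Literature.Analysis.FunctionSpaces
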